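import Summits.CriticalPhenomena.CardyFormulaZ2.Theorems.CardyMagicRigidityNestingRigidityNeckZ2ErrorCover
import Literature.Probability.Percolation.ZdFourArmBoundedRatio
import Literature.Probability.Percolation.LowestCrossingInterface
import HarnessLib

/-!
# Crux `NestingRigidity`, line `pinch-resampling` (v4), stub S12: `ZFourStrandsPositive` (I) — the corridor witnesses

Crux `Summit.CriticalPhenomena.CardyFormulaZ2.Theses.CardyMagicRigidity.NestingRigidity`
(stmt-CriticalPhenomena-4835), line `pinch-resampling` v4, stub S12 `stub_neckHookupCoarseZ2 : NeckHookupCoarseZ2`,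
input `ZFourStrandsPositive` of `neckHookupCoarseZ2_of_inputs` (`…NeckZ2ErrorCover`): RSW positivity of "EXACTLY two
primal-open crossing clusters of `Λ_{2s} ∖ Λ_s` and EXACTLY two dual-open crossing clusters of the dual collar".

Strategy (four files `…NeckZ2Strands{Witnesses,Barrier,Exact,RSW}`).  No template of finitely many box crossings forces
"at most two crossing clusters" (a thin path sneaks between an open fence and the neighbouring dual fence unless they
TOUCH).  Instead: (1) a WITNESSED four-strand event `strandsWitness s` — open corridor walks of `[s+1, 2s+1] × [0, h]` and
its mirror image (one column beyond the collar: the last edge cuts the outer dual ring), closed-dual face walks of the face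
columns `[0, w-1]` from the ring row to the hole row and its mirror image — has probability `≥ c₁` (RSW, Harris,
independence) and gives AT LEAST two primal and two dual crossing clusters (barrier lemma
`not_openConnIn_sqAnnulus_of_dualArmsTB`, and its transpose read on the lattice of faces); (2) a THIRD primal (dual)
crossing cluster is vertex- (face-) disjoint from the witnesses, so the configuration lies in the disjoint occurrence
`strandsWitness s □ (primalStray s ∪ dualStray s)`; (3) Reimer's inequality (`reimer_holds`) bounds the latter by
`P(strandsWitness s) · P(stray)`, and `P(stray) ≤ 1 - c₄` (an open circuit of an inner sub-annulus and a closed dual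
circuit of an outer one kill all crossings, `ThinAnnulusCircuits.lean`).  So `P(ZFourStrands 0 s) ≥ c₁ c₄` (`s ≥ 64`),
and translation invariance finishes.

This file: §1 coordinates of the two collars about the origin and their layers; §2 `PathIn` versus lattice walks and
dual face walks; §3 the events `openWalkLR`, `strandsWitness`; §4 the east, west and top witnesses in the normal form
used downstream (registered anchor `strands_exists_east`: the east open walk after its last visit to the inner column, plus the
sticking-out edge; the bottom witness opens the sequel `…NeckZ2StrandsBarrier`).
-/

noncomputable section

namespace Summit.CriticalPhenomena.CardyFormulaZ2.Cruxes.NestingRigidity.PinchResampling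

open MeasureTheory Set Literature.Probability.Percolation Literature.Probability.LatticeModels SimpleGraph
open ZPinchLocality NeckCoarseZ2

namespace ZStrands

variable {ω : BondConfig (Site 2)} {s : ℕ}

/-! ## §1 Coordinates of the two collars about the origin -/

/-- Membership in the primal box about the origin, in coordinates. -/
theorem mem_zBall_zero {v : Site 2} {n : ℕ} : v ∈ zBall 0 n ↔ |v 0| ≤ n ∧ |v 1| ≤ n := by
  rw [mem_zBall_iff]; simp only [Pi.zero_apply, sub_zero]

/-- Membership in the dual box about the origin (lower-left-corner indexing), in coordinates. -/
theorem mem_zDualBall_zero {z : Site 2} {n : ℕ} :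
    z ∈ zDualBall 0 n ↔ (-(n : ℤ) - 1 ≤ z 0 ∧ z 0 ≤ n) ∧ (-(n : ℤ) - 1 ≤ z 1 ∧ z 1 ≤ n) := by
  rw [mem_zDualBall_iff]; simp only [Pi.zero_apply, sub_zero, abs_le]; omega

/-- The primal collar about the origin is the tree's square annulus `A_{s+1, 2s}`. -/
theorem collar_eq_sqAnnulus (s : ℕ) : zBall 0 (2 * s) \ zBall 0 s = sqAnnulus (s + 1) (2 * s) := by
  ext v
  rw [mem_sdiff, mem_zBall_zero, mem_zBall_zero, mem_sqAnnulus_iff (by omega), Fin.forall_fin_two,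
    Fin.exists_fin_two]
  simp only [abs_le]
  push_cast
  omega

/-- Membership in the primal collar, in coordinates. -/
theorem mem_collar_iff {v : Site 2} : v ∈ zBall 0 (2 * s) \ zBall 0 s ↔
    (|v 0| ≤ 2 * s ∧ |v 1| ≤ 2 * s) ∧ ¬ (|v 0| ≤ s ∧ |v 1| ≤ s) := by
  rw [mem_sdiff, mem_zBall_zero, mem_zBall_zero]; push_cast; rfl

/-- Membership in the dual collar, in coordinates. -/
theorem mem_dualCollar_iff {z : Site 2} : z ∈ zDualBall 0 (2 * s) \ zDualBall 0 s ↔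
    ((-(2 * s : ℤ) - 1 ≤ z 0 ∧ z 0 ≤ 2 * s) ∧ (-(2 * s : ℤ) - 1 ≤ z 1 ∧ z 1 ≤ 2 * s)) ∧
      ¬ ((-(s : ℤ) - 1 ≤ z 0 ∧ z 0 ≤ s) ∧ (-(s : ℤ) - 1 ≤ z 1 ∧ z 1 ≤ s)) := by
  rw [mem_sdiff, mem_zDualBall_zero, mem_zDualBall_zero]; push_cast; rfl

/-- A site of the column `s + 1` at height `|y| ≤ s` lies on the inner layer of the primal collar (east side). -/
theorem mem_innerLayer_east (hs : 1 ≤ s) {v : Site 2} (h0 : v 0 = s + 1) (h1 : |v 1| ≤ s) :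
    v ∈ innerLayer (zdGraph 2) (zBall 0 s) (zBall 0 (2 * s)) := by
  rw [abs_le] at h1
  refine ⟨mem_collar_iff.2 ⟨⟨?_, ?_⟩, fun h ↦ ?_⟩, v - Pi.single 0 1, mem_zBall_zero.2 ⟨?_, ?_⟩, ?_⟩
  · rw [h0, abs_le]; omega
  · rw [abs_le]; omega
  · have := abs_le.1 h.1; rw [h0] at this; omega
  · simp only [Pi.sub_apply, single_zero_apply_zero, h0]; rw [abs_le]; omega
  · simp only [Pi.sub_apply, single_zero_apply_one, sub_zero]; rw [abs_le]; omega
  · rw [zdGraph_adj_iff]; exact ⟨0, Or.inr (by simp)⟩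

/-- A site of the column `-(s + 1)` at height `|y| ≤ s` lies on the inner layer of the primal collar (west side). -/
theorem mem_innerLayer_west (hs : 1 ≤ s) {v : Site 2} (h0 : v 0 = -(s + 1)) (h1 : |v 1| ≤ s) :
    v ∈ innerLayer (zdGraph 2) (zBall 0 s) (zBall 0 (2 * s)) := by
  rw [abs_le] at h1
  refine ⟨mem_collar_iff.2 ⟨⟨?_, ?_⟩, fun h ↦ ?_⟩, v + Pi.single 0 1, mem_zBall_zero.2 ⟨?_, ?_⟩, ?_⟩
  · rw [h0, abs_le]; omega
  · rw [abs_le]; omega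
  · have := abs_le.1 h.1; rw [h0] at this; omega
  · simp only [Pi.add_apply, single_zero_apply_zero, h0]; rw [abs_le]; omega
  · simp only [Pi.add_apply, single_zero_apply_one, add_zero]; rw [abs_le]; omega
  · rw [zdGraph_adj_iff]; exact ⟨0, Or.inl (by simp)⟩

/-- A site of the column `± 2s` at height `|y| ≤ 2s` lies on the outer layer of the primal collar. -/
theorem mem_outerLayer_of_apply_zero (hs : 1 ≤ s) {v : Site 2} (h0 : v 0 = 2 * s ∨ v 0 = -(2 * s))
    (h1 : |v 1| ≤ 2 * s) : v ∈ outerLayer (zdGraph 2) (zBall 0 s) (zBall 0 (2 * s)) := by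
  rw [abs_le] at h1
  rcases h0 with h0 | h0
  · refine ⟨mem_collar_iff.2 ⟨⟨?_, ?_⟩, fun h ↦ ?_⟩, v + Pi.single 0 1, fun h ↦ ?_, ?_⟩
    · rw [h0, abs_le]; omega
    · rw [abs_le]; omega
    · have := abs_le.1 h.1; rw [h0] at this; omega
    · have := abs_le.1 (mem_zBall_zero.1 h).1
      simp only [Pi.add_apply, single_zero_apply_zero, h0] at this; omega
    · rw [zdGraph_adj_iff]; exact ⟨0, Or.inl (by simp)⟩
  · refine ⟨mem_collar_iff.2 ⟨⟨?_, ?_⟩, fun h ↦ ?_⟩, v - Pi.single 0 1, fun h ↦ ?_, ?_⟩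
    · rw [h0, abs_le]; omega
    · rw [abs_le]; omega
    · have := abs_le.1 h.1; rw [h0] at this; omega
    · have := abs_le.1 (mem_zBall_zero.1 h).1
      simp only [Pi.sub_apply, single_zero_apply_zero, h0] at this; omega
    · rw [zdGraph_adj_iff]; exact ⟨0, Or.inr (by simp)⟩

/-- A face of the row `s + 1` above the hole lies on the inner layer of the dual collar (top side). -/
theorem mem_innerLayer_dual_top (hs : 1 ≤ s) {z : Site 2} (h1 : z 1 = s + 1) (h0 : -(s : ℤ) - 1 ≤ z 0 ∧ z 0 ≤ s) :
    z ∈ innerLayer (zdGraph 2) (zDualBall 0 s) (zDualBall 0 (2 * s)) := by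
  refine ⟨mem_dualCollar_iff.2 ⟨⟨?_, ?_⟩, fun h ↦ ?_⟩, z - Pi.single 1 1, mem_zDualBall_zero.2 ⟨?_, ?_⟩, ?_⟩
  · omega
  · rw [h1]; omega
  · rw [h1] at h; omega
  · simp only [Pi.sub_apply, single_one_apply_zero, sub_zero]; omega
  · simp only [Pi.sub_apply, single_one_apply_one, h1]; omega
  · rw [zdGraph_adj_iff]; exact ⟨1, Or.inr (by simp)⟩

/-- A face of the row `-(s + 2)` below the hole lies on the inner layer of the dual collar (bottom side). -/
theorem mem_innerLayer_dual_bot (hs : 1 ≤ s) {z : Site 2} (h1 : z 1 = -(s + 2)) (h0 : -(s : ℤ) - 1 ≤ z 0 ∧ z 0 ≤ s) :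
    z ∈ innerLayer (zdGraph 2) (zDualBall 0 s) (zDualBall 0 (2 * s)) := by
  refine ⟨mem_dualCollar_iff.2 ⟨⟨?_, ?_⟩, fun h ↦ ?_⟩, z + Pi.single 1 1, mem_zDualBall_zero.2 ⟨?_, ?_⟩, ?_⟩
  · omega
  · rw [h1]; omega
  · rw [h1] at h; omega
  · simp only [Pi.add_apply, single_one_apply_zero, add_zero]; omega
  · simp only [Pi.add_apply, single_one_apply_one, h1]; omega
  · rw [zdGraph_adj_iff]; exact ⟨1, Or.inl (by simp)⟩

/-- A face of the ring rows `2s` / `-(2s + 1)` lies on the outer layer of the dual collar. -/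
theorem mem_outerLayer_dual (hs : 1 ≤ s) {z : Site 2} (h1 : z 1 = 2 * s ∨ z 1 = -(2 * s + 1))
    (h0 : -(2 * s : ℤ) - 1 ≤ z 0 ∧ z 0 ≤ 2 * s) :
    z ∈ outerLayer (zdGraph 2) (zDualBall 0 s) (zDualBall 0 (2 * s)) := by
  rcases h1 with h1 | h1
  · refine ⟨mem_dualCollar_iff.2 ⟨⟨?_, ?_⟩, fun h ↦ ?_⟩, z + Pi.single 1 1, fun h ↦ ?_, ?_⟩
    · omega
    · rw [h1]; omega
    · rw [h1] at h; omega
    · have := (mem_zDualBall_zero.1 h).2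
      simp only [Pi.add_apply, single_one_apply_one, h1] at this; omega
    · rw [zdGraph_adj_iff]; exact ⟨1, Or.inl (by simp)⟩
  · refine ⟨mem_dualCollar_iff.2 ⟨⟨?_, ?_⟩, fun h ↦ ?_⟩, z - Pi.single 1 1, fun h ↦ ?_, ?_⟩
    · omega
    · rw [h1]; omega
    · rw [h1] at h; omega
    · have := (mem_zDualBall_zero.1 h).2
      simp only [Pi.sub_apply, single_one_apply_one, h1] at this; omega
    · rw [zdGraph_adj_iff]; exact ⟨1, Or.inr (by simp)⟩

/-! ## §2 Open walks, dual face walks -/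

/-- A dual step between lattice-adjacent faces is dual-open iff the primal edge it crosses is closed. -/
theorem mk_mem_dualConfig_iff {z z' : Site 2} (h : (zdGraph 2).Adj z z') :
    s(z, z') ∈ dualConfig ω ↔ sepEdge z z' ∉ ω := by
  rw [mem_dualConfig_iff]
  constructor
  · rintro ⟨-, hne⟩ hmem
    exact hne _ hmem (dualEdge_sepEdge h)
  · intro hn
    refine ⟨(mem_edgeSet _).2 h, fun e' he' heq ↦ hn ?_⟩
    rw [← dualEdge_sepEdge h] at heq
    rwa [← dualEdge_bijective.injective heq]

/-- A face walk all of whose steps cross closed edges is a dual-open walk. -/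
theorem forall_edges_mem_dualConfig {a b : Site 2} (W : (zdGraph 2).Walk a b)
    (hW : ∀ d ∈ W.darts, sepEdge d.fst d.snd ∉ ω) : ∀ e ∈ W.edges, e ∈ dualConfig ω := by
  intro e he
  rw [Walk.edges, List.mem_map] at he
  obtain ⟨d, hd, rfl⟩ := he
  exact (mk_mem_dualConfig_iff d.adj).2 (hW d hd)

/-- Conversely, a dual-open walk crosses closed edges only. -/
theorem forall_darts_sepEdge_notMem {a b : Site 2} (W : (zdGraph 2).Walk a b)
    (hW : ∀ e ∈ W.edges, e ∈ dualConfig ω) : ∀ d ∈ W.darts, sepEdge d.fst d.snd ∉ ω := fun d hd ↦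
  (mk_mem_dualConfig_iff d.adj).1 (hW _ (List.mem_map.2 ⟨d, hd, rfl⟩))

/-- A `PathIn` of the open graph is an open walk of the lattice (lattice configurations). -/
theorem exists_walk_of_pathIn (hω : ω ⊆ (zdGraph 2).edgeSet) {S : Set (Site 2)} {u v : Site 2}
    (h : PathIn (openGraph ω) S u v) :
    ∃ p : (zdGraph 2).Walk u v, (∀ z ∈ p.support, z ∈ S) ∧ ∀ e ∈ p.edges, e ∈ ω :=
  exists_walk_of_mem_openConnIn hω (DCT16.mem_openConnIn_iff_pathIn.2 h)

/-- An open walk of the lattice inside `S` is a `PathIn` of the open graph. -/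
theorem pathIn_of_walk {S : Set (Site 2)} {u v : Site 2} (p : (zdGraph 2).Walk u v)
    (hS : ∀ z ∈ p.support, z ∈ S) (hp : ∀ e ∈ p.edges, e ∈ ω) : PathIn (openGraph ω) S u v :=
  DCT16.mem_openConnIn_iff_pathIn.1 (mem_openConnIn_of_walk p hS hp)

/-- A `PathIn` of the dual-open graph is a face walk crossing closed edges only. -/
theorem exists_faceWalk_of_pathIn {S : Set (Site 2)} {u v : Site 2}
    (h : PathIn (openGraph (dualConfig ω)) S u v) :
    ∃ p : (zdGraph 2).Walk u v, (∀ z ∈ p.support, z ∈ S) ∧ ∀ d ∈ p.darts, sepEdge d.fst d.snd ∉ ω := by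
  obtain ⟨p, hpS, hpe⟩ := exists_walk_of_mem_openConnIn (G := zdGraph 2) (ω := dualConfig ω) sdiff_subset
    (DCT16.mem_openConnIn_iff_pathIn.2 h)
  exact ⟨p, hpS, forall_darts_sepEdge_notMem p hpe⟩

/-- A face walk inside `S` crossing closed edges only is a `PathIn` of the dual-open graph. -/
theorem dualPathIn_of_faceWalk {S : Set (Site 2)} {u v : Site 2} (p : (zdGraph 2).Walk u v)
    (hS : ∀ z ∈ p.support, z ∈ S) (hp : ∀ d ∈ p.darts, sepEdge d.fst d.snd ∉ ω) :
    PathIn (openGraph (dualConfig ω)) S u v :=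
  DCT16.mem_openConnIn_iff_pathIn.1 (mem_openConnIn_of_walk p hS (forall_edges_mem_dualConfig p hp))

/-- The start of a prefix (`takeUntil`) is joined to the cut vertex inside any set containing the walk. -/
theorem pathIn_takeUntil {S : Set (Site 2)} {u v a : Site 2} (p : (zdGraph 2).Walk u v)
    (hS : ∀ z ∈ p.support, z ∈ S) (hp : ∀ e ∈ p.edges, e ∈ ω) (ha : a ∈ p.support) :
    PathIn (openGraph ω) S u a :=
  pathIn_of_walk (p.takeUntil a ha) (fun z hz ↦ hS z (p.support_takeUntil_subset_support ha hz))
    fun e he ↦ hp e (p.edges_takeUntil_subset_edges ha he)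

/-- Dual version of `pathIn_takeUntil`. -/
theorem dualPathIn_takeUntil {S : Set (Site 2)} {u v a : Site 2} (p : (zdGraph 2).Walk u v)
    (hS : ∀ z ∈ p.support, z ∈ S) (hp : ∀ d ∈ p.darts, sepEdge d.fst d.snd ∉ ω) (ha : a ∈ p.support) :
    PathIn (openGraph (dualConfig ω)) S u a :=
  dualPathIn_of_faceWalk (p.takeUntil a ha) (fun z hz ↦ hS z (p.support_takeUntil_subset_support ha hz))
    fun d hd ↦ hp d (p.darts_takeUntil_subset_darts ha hd)

/-- Edges of a walk come from its darts. -/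
theorem mem_edges_iff_darts {V : Type*} {G : SimpleGraph V} {u v : V} {e : Sym2 V} (p : G.Walk u v) :
    e ∈ p.edges ↔ ∃ d ∈ p.darts, d.edge = e := by
  rw [Walk.edges, List.mem_map]

/-! ## §3 The witnessed four-strand event and the two stray events -/

/-- **Walk form of an open left–right crossing** of `[u₀, u₀ + M] × [u₁, u₁ + n]` (the conclusion of
`exists_walk_of_mem_lrCrossingAt`): a cylinder-stable event. -/
def openWalkLR (u : Site 2) (M n : ℕ) : Set (BondConfig (Site 2)) :=
  {ω | ∃ (x y : Site 2) (T : (zdGraph 2).Walk x y), x 0 = u 0 ∧ y 0 = u 0 + M ∧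
    (∀ z ∈ T.support, u 0 ≤ z 0 ∧ z 0 ≤ u 0 + M ∧ u 1 ≤ z 1 ∧ z 1 ≤ u 1 + n) ∧ ∀ e ∈ T.edges, e ∈ ω}

/-- On lattice configurations the tree's crossing event `lrCrossingAt` implies its walk form. -/
theorem openWalkLR_of_lrCrossingAt (hω : ω ⊆ (zdGraph 2).edgeSet) {u : Site 2} {M n : ℕ}
    (h : ω ∈ lrCrossingAt u M n) : ω ∈ openWalkLR u M n :=
  exists_walk_of_mem_lrCrossingAt hω h

/-- Corridor height parameter `2 ⌊s/8⌋ - 1` (the open corridors are `[s+1, 2s+1] × [0, hq s]` and its mirror image). -/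
def hq (s : ℕ) : ℕ := 2 * (s / 8) - 1

/-- Dual corridor width `⌊s/8⌋` (the dual corridors are the face columns `[0, wq s - 1]` above and below the hole). -/
def wq (s : ℕ) : ℕ := s / 8

/-- **The witnessed four-strand event at the origin** (scale `s`, collar `Λ_{2s} ∖ Λ_s`): open walk crossings of
`[s+1, 2s+1] × [0, hq s]` and of `[-(2s+1), -(s+1)] × [0, hq s]` (one column BEYOND the outer layer, so that the
last edge cuts the outer dual ring), and closed-dual face walks of the face columns `[0, wq s - 1]` from the ring
row `2s` to the hole row `s`, resp. from the hole row `-(s+1)` to the ring row `-(2s+1)` (the tree's corridor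
events `dualFaceCrossing`). -/
def strandsWitness (s : ℕ) : Set (BondConfig (Site 2)) :=
  (openWalkLR ![(s : ℤ) + 1, 0] s (hq s) ∩ openWalkLR ![-(2 * (s : ℤ) + 1), 0] s (hq s)) ∩
    (dualFaceCrossing ![0, (s : ℤ) + 1] (wq s) (s - 1) ∩ dualFaceCrossing ![0, -(2 * (s : ℤ))] (wq s) (s - 1))

/-! ## §4 The four witnesses in normal form -/

/-- **East witness**: an open walk `R` of `[s+1, 2s] × [0, hq s]` from the inner east column `s + 1` (left after
the first step for good) to a site `p` of the outer column `2s`, followed by the open sticking-out edge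
`{p, p + e₀}`. -/
theorem strands_exists_east : ∀ (ω : BondConfig (Site 2)) (s : ℕ), 1 ≤ s → ω ∈ openWalkLR ![(s : ℤ) + 1, 0] s (hq s) → ∃ (e p : Site 2) (R : (zdGraph 2).Walk e p), e 0 = s + 1 ∧ p 0 = 2 * s ∧ (∀ z ∈ R.support, ((s : ℤ) + 1 ≤ z 0 ∧ z 0 ≤ 2 * s) ∧ (0 ≤ z 1 ∧ z 1 ≤ hq s)) ∧ (∀ d ∈ R.darts, (s : ℤ) + 2 ≤ d.snd 0) ∧ (∀ ed ∈ R.edges, ed ∈ ω) ∧ s(p, p + Pi.single 0 1) ∈ ω := by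
  intro ω s hs h
  obtain ⟨x, y, T, hx, hy, hTs, hTe⟩ := h
  simp only [Matrix.cons_val_zero, Matrix.cons_val_one] at hx hy hTs
  obtain ⟨a', ha', b', hb', q, hqd, hqB, hqA⟩ :=
    exists_subwalk_inter_free (A := {z : Site 2 | z 0 = (s : ℤ) + 1})
      (B := {z : Site 2 | z 0 = (s : ℤ) + 1 + s}) T hx hy
  have ha'0 : a' 0 = (s : ℤ) + 1 := ha'
  have hb'0 : b' 0 = (s : ℤ) + 1 + s := hb'
  have hnil : ¬ q.Nil := Walk.not_nil_of_ne fun h ↦ by rw [h] at ha'0; omega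
  have hadj : (zdGraph 2).Adj q.penultimate b' := q.adj_penultimate hnil
  have hcat : q.dropLast.concat hadj = q := Walk.concat_dropLast hadj
  -- the vertices of `R = q.dropLast` are the first vertices of the darts of `q`
  have hRs : ∀ z ∈ q.dropLast.support, ∃ d ∈ q.darts, d.fst = z := fun z hz ↦ by
    rw [Walk.support_dropLast hnil, ← Walk.map_fst_darts] at hz
    simpa using hz
  have hbnd : ∀ z ∈ q.dropLast.support, ((s : ℤ) + 1 ≤ z 0 ∧ z 0 ≤ 2 * s) ∧ (0 ≤ z 1 ∧ z 1 ≤ hq s) := by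
    intro z hz
    obtain ⟨d, hd, rfl⟩ := hRs z hz
    have h1 := hTs _ (T.dart_fst_mem_support_of_mem_darts (hqd d hd))
    have h2 : d.fst 0 ≠ (s : ℤ) + 1 + s := hqB d hd
    omega
  have hpen : q.penultimate 0 = 2 * s := by
    have h1 := hbnd _ q.dropLast.end_mem_support
    rcases stepKind_of_adj hadj with ⟨h0, -⟩ | ⟨h0, -⟩ | ⟨-, h0⟩ | ⟨-, h0⟩ <;> omega
  have hb'eq : b' = q.penultimate + Pi.single 0 1 := by
    have h1 := hbnd _ q.dropLast.end_mem_support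
    rw [Site.eq_iff_two]
    rcases stepKind_of_adj hadj with ⟨h0, h1'⟩ | ⟨h0, h1'⟩ | ⟨h1', h0⟩ | ⟨h1', h0⟩ <;>
      simp only [Pi.add_apply, single_zero_apply_zero, single_zero_apply_one] <;> omega
  have hqe : ∀ ed ∈ q.edges, ed ∈ ω := fun ed hed ↦ by
    obtain ⟨d, hd, rfl⟩ := (mem_edges_iff_darts q).1 hed
    exact hTe _ ((mem_edges_iff_darts T).2 ⟨d, hqd d hd, rfl⟩)
  refine ⟨a', q.penultimate, q.dropLast, ha'0, hpen, hbnd, fun d hd ↦ ?_, fun ed hed ↦ ?_, ?_⟩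
  · have hd' : d ∈ q.darts := by
      rw [← hcat, Walk.darts_concat, List.concat_eq_append]; exact List.mem_append_left _ hd
    have h1 : d.snd 0 ≠ (s : ℤ) + 1 := hqA d hd'
    have h2 := (hbnd _ (q.dropLast.dart_snd_mem_support_of_mem_darts hd)).1.1
    omega
  · refine hqe ed ?_
    rw [← hcat, Walk.edges_concat, List.concat_eq_append]; exact List.mem_append_left _ hed
  · rw [← hb'eq]
    refine hqe _ ?_
    rw [← hcat, Walk.edges_concat, List.concat_eq_append]; simp

/-- **West witness** (mirror image of `strands_exists_east`). -/
theorem exists_west (hs : 1 ≤ s) (h : ω ∈ openWalkLR ![-(2 * (s : ℤ) + 1), 0] s (hq s)) :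
    ∃ (w p : Site 2) (R : (zdGraph 2).Walk w p), w 0 = -((s : ℤ) + 1) ∧ p 0 = -(2 * (s : ℤ)) ∧
      (∀ z ∈ R.support, (-(2 * (s : ℤ)) ≤ z 0 ∧ z 0 ≤ -((s : ℤ) + 1)) ∧ (0 ≤ z 1 ∧ z 1 ≤ hq s)) ∧
      (∀ ed ∈ R.edges, ed ∈ ω) ∧ s(p, p - Pi.single 0 1) ∈ ω := by
  obtain ⟨x, y, T, hx, hy, hTs, hTe⟩ := h
  simp only [Matrix.cons_val_zero, Matrix.cons_val_one] at hx hy hTs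
  obtain ⟨a', ha', b', hb', q, hqd, hqB, hqA⟩ :=
    exists_subwalk_inter_free (A := {z : Site 2 | z 0 = -(2 * (s : ℤ) + 1) + s})
      (B := {z : Site 2 | z 0 = -(2 * (s : ℤ) + 1)}) T.reverse hy hx
  have ha'0 : a' 0 = -(2 * (s : ℤ) + 1) + s := ha'
  have hb'0 : b' 0 = -(2 * (s : ℤ) + 1) := hb'
  have hnil : ¬ q.Nil := Walk.not_nil_of_ne fun h ↦ by rw [h] at ha'0; omega
  have hadj : (zdGraph 2).Adj q.penultimate b' := q.adj_penultimate hnil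
  have hcat : q.dropLast.concat hadj = q := Walk.concat_dropLast hadj
  have hRs : ∀ z ∈ q.dropLast.support, ∃ d ∈ q.darts, d.fst = z := fun z hz ↦ by
    rw [Walk.support_dropLast hnil, ← Walk.map_fst_darts] at hz
    simpa using hz
  have hbnd : ∀ z ∈ q.dropLast.support,
      (-(2 * (s : ℤ)) ≤ z 0 ∧ z 0 ≤ -((s : ℤ) + 1)) ∧ (0 ≤ z 1 ∧ z 1 ≤ hq s) := by
    intro z hz
    obtain ⟨d, hd, rfl⟩ := hRs z hz
    have h0 := T.reverse.dart_fst_mem_support_of_mem_darts (hqd d hd)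
    rw [Walk.support_reverse, List.mem_reverse] at h0
    have h1 := hTs _ h0
    have h2 : d.fst 0 ≠ -(2 * (s : ℤ) + 1) := hqB d hd
    omega
  have hpen : q.penultimate 0 = -(2 * (s : ℤ)) := by
    have h1 := hbnd _ q.dropLast.end_mem_support
    rcases stepKind_of_adj hadj with ⟨h0, -⟩ | ⟨h0, -⟩ | ⟨-, h0⟩ | ⟨-, h0⟩ <;> omega
  have hb'eq : b' = q.penultimate - Pi.single 0 1 := by
    have h1 := hbnd _ q.dropLast.end_mem_support
    rw [Site.eq_iff_two]
    rcases stepKind_of_adj hadj with ⟨h0, h1'⟩ | ⟨h0, h1'⟩ | ⟨h1', h0⟩ | ⟨h1', h0⟩ <;>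
      simp only [Pi.sub_apply, single_zero_apply_zero, single_zero_apply_one] <;> omega
  have hqe : ∀ ed ∈ q.edges, ed ∈ ω := fun ed hed ↦ by
    obtain ⟨d, hd, rfl⟩ := (mem_edges_iff_darts q).1 hed
    have := (mem_edges_iff_darts T.reverse).2 ⟨d, hqd d hd, rfl⟩
    rw [Walk.edges_reverse, List.mem_reverse] at this
    exact hTe _ this
  refine ⟨a', q.penultimate, q.dropLast, by omega, hpen, hbnd, fun ed hed ↦ ?_, ?_⟩
  · refine hqe ed ?_
    rw [← hcat, Walk.edges_concat, List.concat_eq_append]; exact List.mem_append_left _ hed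
  · rw [← hb'eq]
    refine hqe _ ?_
    rw [← hcat, Walk.edges_concat, List.concat_eq_append]; simp

/-- **Top dual witness**: a face walk `U` of the face columns `[0, wq s - 1]` from a ring face `a` (row `2s`) down to a
face `f` of the row `s + 1` (dual inner layer), all faces in the rows `[s+1, 2s]`, crossing closed edges only, followed
by the closed step into the hole face `f - e₁`. -/
theorem exists_top (hs : 1 ≤ s) (h : ω ∈ dualFaceCrossing ![0, (s : ℤ) + 1] (wq s) (s - 1)) :
    ∃ (a f : Site 2) (U : (zdGraph 2).Walk a f), a 1 = 2 * s ∧ f 1 = s + 1 ∧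
      (∀ g ∈ U.support, (0 ≤ g 0 ∧ g 0 + 1 ≤ wq s) ∧ ((s : ℤ) + 1 ≤ g 1 ∧ g 1 ≤ 2 * s)) ∧
      (∀ d ∈ U.darts, sepEdge d.fst d.snd ∉ ω) ∧ sepEdge f (f - Pi.single 1 1) ∉ ω := by
  obtain ⟨a, b, W, ha, hb, hWs, hWc⟩ := h
  simp only [Matrix.cons_val_zero, Matrix.cons_val_one] at ha hb hWs
  obtain ⟨x, z, q₁, hxz, hz, hq₁A, hq₁s, hq₁e, hlast⟩ :=
    exists_prefix_exit (A := {v : Site 2 | (s : ℤ) + 1 ≤ v 1}) W (show (s : ℤ) + 1 ≤ a 1 by omega)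
      (show ¬ ((s : ℤ) + 1 ≤ b 1) by omega)
  have hzW := hWs z (W.snd_mem_support_of_mem_edges hlast)
  have hx := hWs x (hq₁s x q₁.end_mem_support)
  have hxA : (s : ℤ) + 1 ≤ x 1 := hq₁A x q₁.end_mem_support
  have hz' : ¬ (s : ℤ) + 1 ≤ z 1 := hz
  have hzeq : z = x - Pi.single 1 1 := by
    rw [Site.eq_iff_two]
    rcases stepKind_of_adj hxz with ⟨h0, h1⟩ | ⟨h0, h1⟩ | ⟨h1, h0⟩ | ⟨h1, h0⟩ <;>
      simp only [Pi.sub_apply, single_one_apply_zero, single_one_apply_one] <;> omega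
  refine ⟨a, x, q₁, by omega, ?_, fun g hg ↦ ?_, forall_darts_sepEdge_notMem_of_edges W hWc q₁ hq₁e, ?_⟩
  · rcases stepKind_of_adj hxz with ⟨h0, h1⟩ | ⟨h0, h1⟩ | ⟨h1, h0⟩ | ⟨h1, h0⟩ <;> omega
  · have h1 := hWs g (hq₁s g hg)
    have h2 : (s : ℤ) + 1 ≤ g 1 := hq₁A g hg
    omega
  · rw [← hzeq]; exact sepEdge_notMem_of_mem_edges W hWc hlast

end ZStrands

end Summit.CriticalPhenomena.CardyFormulaZ2.Cruxes.NestingRigidity.PinchResampling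

end
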